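import Summits.ValiantsHypothesis.ValiantsHypothesis.Theorems.DivisionGapPerCofactorDegreeReductionWindowGlue
import Summits.ValiantsHypothesis.ValiantsHypothesis.Theorems.DivisionGapPerCofactorDegreeReductionStubContentSplit
import Summits.ValiantsHypothesis.ValiantsHypothesis.Theorems.DivisionGapPerCofactorDegreeReductionStubMonomialStripping
import Summits.ValiantsHypothesis.ValiantsHypothesis.Theorems.DivisionGapPerMultiplesHardStubMultihomogeneousNormalForm

/-!
# Crux `DivisionGap.PerCofactorDegreeReduction` (stmt-ValiantsHypothesis-15046), line `Sketch` —
# the WINDOW of the crux, part 2: the crux is equivalent to its restriction to the window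

`PerCofactorDegreeReduction` (PCDR): `∃ k, ∀ n, ∀ h ≠ 0, ∃ h' ≠ 0, deg h' ≤ B ∧ L(per_n · h') ≤ B`,
`B = 2 ^ ((log₂ n + log₂ L(per_n · h) + k) ^ k)`, `L = complexity` over `ℝ≥0`.

* `perCofactorDegreeReduction_iff_window` — **PCDR ⟺ PCDR restricted to the WINDOW**: nonzero
  cofactors `h` that are SINGLE-TYPED (all monomials share the row margins and the column margins),
  CONTENT-FREE (no variable divides `h`), in the SUB-EXPONENTIAL regime `B < L(per_n)` and of HIGH
  DEGREE `B < deg h`.  Outside the window the crux is a theorem of the tree: `h' = 1` when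
  `L(per_n) ≤ B`; the free bottom slice `h♭ = h_{ord h}` (`Window.exists_bottom_slice`, from
  `stub_bottomComponentFree`) when `ord h ≤ B`; single-typing is free
  (`PerMultiplesHard.NormalForm.stub_multihomogeneousNormalForm`); splitting off the monomial
  content `h₁ = x^M h₂` (`stub_contentSplit`) costs a polynomial factor (`stub_monomialStripping`,
  Jukna–Seiwert–Sergeev 2022 Thm 1) and `h' = h₂` works when `deg h₂ ≤ B`; the bookkeeping is
  `Window.qp_absorb`.  So the open content of the crux is exactly: cheap, single-typed,
  content-free cofactors of degree in `(2^{polylog(n,s)}, 2^s]` in the regime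
  `s < 2^{(n log n)^{1/k}}` (where `h' = 1` is unaffordable) — the additive-hiding /
  repeated-squaring regime named by the item (HrubesYehudayoff2021 Rem 45, §6 Problem 2;
  Jukna 2023 §6.5 Problem 4: no lower bound for any monotone multiple of `per_n` beyond counting
  inputs is known, and no monotone degree-lowering operation is known).
* `creationDegreeWindow_of_perCofactorDegreeReduction` — the line's open stub K1-on-the-window
  (`stub_creationDegreeWindow` of `Cruxes/PerCofactorDegreeReduction/Lines/Sketch.lean`: a cheap
  nonnegative element of the ideal `(per_n) ⊂ ℝ[x]` of quasi-polynomial degree, signed cofactor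
  allowed) is NECESSARY for the crux (`A := per_n · h'`, one permanent factor absorbed by
  `qp_step`).  Together with the skeleton's composition (K1|window ∧ K2|window ⇒ PCDR) this places
  K1|window between the crux and the crux-plus-K2.

Line lead prover-line-stmt-ValiantsHypothesis-15046-c1-0, cycle 2 (2026-08-16).  No definitions,
no named facts; Mathlib + tree only.
-/

noncomputable section

-- `Summit.ValiantsHypothesis.ValiantsHypothesis.…` is the tree's mandated single-conjunct layout
-- (Problem = Summit), so the duplicated namespace component is intended.
set_option linter.dupNamespace false

namespace Summit.ValiantsHypothesis.ValiantsHypothesis.Theorems.DivisionGap.PerCofactorDegreeReduction.Window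

open MvPolynomial Literature.Computability.AlgebraicComplexity
open Summit.ValiantsHypothesis.Theorems.PerCofactorDegreeReductionNegative (lt_two_pow_qp qp_mono)
open scoped NNReal BigOperators

/-! ### The crux is equivalent to its restriction to the window -/

/-- **THE CRUX LIVES ON ITS WINDOW (K2-free; cycle 2).**  `PerCofactorDegreeReduction` is
EQUIVALENT to its restriction to nonzero cofactors `h` that are single-typed, content-free, in the
sub-exponential regime `B < L(per_n)` and of high degree `B < deg h`
(`B = 2^((log₂ n + log₂ L(per_n·h) + k)^k)`): outside the window the witnesses `h' = 1`, the free
bottom slice `h♭`, and the content-stripped slice `h₂` (`stub_bottomComponentFree`,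
`stub_multihomogeneousNormalForm`, `stub_contentSplit`, `stub_monomialStripping`) already work. -/
theorem perCofactorDegreeReduction_iff_window :
    Summit.ValiantsHypothesis.ValiantsHypothesis.Theses.DivisionGap.PerCofactorDegreeReduction ↔
    ∃ k : ℕ, ∀ (n : ℕ) (h : MvPolynomial (Fin n × Fin n) ℝ≥0), h ≠ 0 →
      (∃ τ : (Fin n →₀ ℕ) × (Fin n →₀ ℕ),
          ∀ m ∈ h.support, (Finsupp.mapDomain Prod.fst m, Finsupp.mapDomain Prod.snd m) = τ) →
      (∀ v : Fin n × Fin n, ∃ m ∈ h.support, m v = 0) →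
      2 ^ ((Nat.log 2 n + Nat.log 2 (complexity (perPoly (Fin n) ℝ≥0 * h)) + k) ^ k) <
        complexity (perPoly (Fin n) ℝ≥0) →
      2 ^ ((Nat.log 2 n + Nat.log 2 (complexity (perPoly (Fin n) ℝ≥0 * h)) + k) ^ k) <
        h.totalDegree →
      ∃ h' : MvPolynomial (Fin n × Fin n) ℝ≥0, h' ≠ 0 ∧
        h'.totalDegree ≤
          2 ^ ((Nat.log 2 n + Nat.log 2 (complexity (perPoly (Fin n) ℝ≥0 * h)) + k) ^ k) ∧
        complexity (perPoly (Fin n) ℝ≥0 * h') ≤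
          2 ^ ((Nat.log 2 n + Nat.log 2 (complexity (perPoly (Fin n) ℝ≥0 * h)) + k) ^ k) := by
  classical
  constructor
  · rintro ⟨k, hk⟩
    exact ⟨k, fun n h hh _ _ _ _ => hk n h hh⟩
  rintro ⟨k, hk⟩
  obtain ⟨c, hc⟩ :=
    Summit.ValiantsHypothesis.ValiantsHypothesis.Theorems.DivisionGap.PerCofactorDegreeReduction.MonomialStripping.stub_monomialStripping
  obtain ⟨K, hK1, hK⟩ := qp_absorb c k
  refine ⟨K, fun n h hh => ?_⟩
  set s := complexity (perPoly (Fin n) ℝ≥0 * h) with hs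
  have hsB : s ≤ 2 ^ ((Nat.log 2 n + Nat.log 2 s + K) ^ K) := self_le_two_pow_qp s _ K hK1
  -- (H) the hard regime: `h' = 1`
  by_cases hH : complexity (perPoly (Fin n) ℝ≥0) ≤ 2 ^ ((Nat.log 2 n + Nat.log 2 s + K) ^ K)
  · exact ⟨1, one_ne_zero, by simp, by rwa [mul_one]⟩
  push Not at hH
  -- (O) the bottom slice: `h' = h♭`
  obtain ⟨d, hb, hb0, -, -, hbdeg, hLb⟩ := exists_bottom_slice h hh
  by_cases hO : d ≤ 2 ^ ((Nat.log 2 n + Nat.log 2 s + K) ^ K)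
  · exact ⟨hb, hb0, hbdeg ▸ hO, hLb.trans hsB⟩
  push Not at hO
  -- single-typing (free) and content splitting (polynomial): `h' = h₂`
  obtain ⟨h₁, h₁0, h₁sub, ⟨τ, hτ⟩, hL₁, -⟩ :=
    Summit.ValiantsHypothesis.ValiantsHypothesis.Theorems.DivisionGap.PerMultiplesHard.NormalForm.stub_multihomogeneousNormalForm
      n hb hb0
  obtain ⟨M, h₂, hMh₂, hfree, hsupp₂⟩ :=
    Summit.ValiantsHypothesis.ValiantsHypothesis.Theorems.DivisionGap.PerCofactorDegreeReduction.ContentSplit.stub_contentSplit n h₁ h₁0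
  have h₂0 : h₂ ≠ 0 := by rintro rfl; exact h₁0 (by rw [← hMh₂, mul_zero])
  have hL₂ : complexity (perPoly (Fin n) ℝ≥0 * h₂) ≤ c * (n + 1) ^ c * (s + 1) ^ c := by
    refine (hc n M (perPoly (Fin n) ℝ≥0 * h₂)).trans ?_
    have : monomial M 1 * (perPoly (Fin n) ℝ≥0 * h₂) = perPoly (Fin n) ℝ≥0 * h₁ := by
      rw [mul_left_comm, hMh₂]
    rw [this]
    gcongr
    exact hL₁.trans hLb
  obtain ⟨hKa, hKb⟩ := hK n s _ hL₂
  by_cases hO₂ : h₂.totalDegree ≤ 2 ^ ((Nat.log 2 n + Nat.log 2 s + K) ^ K)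
  · exact ⟨h₂, h₂0, hO₂, hL₂.trans hKb⟩
  push Not at hO₂
  -- (R) the window
  have htyped : ∃ τ₂ : (Fin n →₀ ℕ) × (Fin n →₀ ℕ), ∀ m ∈ h₂.support,
      (Finsupp.mapDomain Prod.fst m, Finsupp.mapDomain Prod.snd m) = τ₂ := by
    refine ⟨(τ.1 - Finsupp.mapDomain Prod.fst M, τ.2 - Finsupp.mapDomain Prod.snd M),
      fun x hx => ?_⟩
    obtain ⟨m, hm, hMm, rfl⟩ := hsupp₂ x hx
    have hmt := hτ m hm
    have h1 : Finsupp.mapDomain Prod.fst m = τ.1 := by rw [← hmt]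
    have h2 : Finsupp.mapDomain Prod.snd m = τ.2 := by rw [← hmt]
    have hsplit : m = M + (m - M) := (add_tsub_cancel_of_le hMm).symm
    refine Prod.ext ?_ ?_
    · show Finsupp.mapDomain Prod.fst (m - M) = τ.1 - Finsupp.mapDomain Prod.fst M
      rw [← h1]
      conv_rhs => rw [hsplit, Finsupp.mapDomain_add]
      rw [add_tsub_cancel_left]
    · show Finsupp.mapDomain Prod.snd (m - M) = τ.2 - Finsupp.mapDomain Prod.snd M
      rw [← h2]
      conv_rhs => rw [hsplit, Finsupp.mapDomain_add]
      rw [add_tsub_cancel_left]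
  have hexp : 2 ^ ((Nat.log 2 n + Nat.log 2 (complexity (perPoly (Fin n) ℝ≥0 * h₂)) + k) ^ k) <
      complexity (perPoly (Fin n) ℝ≥0) := by omega
  have hdeg : 2 ^ ((Nat.log 2 n + Nat.log 2 (complexity (perPoly (Fin n) ℝ≥0 * h₂)) + k) ^ k) <
      h₂.totalDegree := by omega
  obtain ⟨h', hh'0, hdeg', hL'⟩ := hk n h₂ h₂0 htyped hfree hexp hdeg
  exact ⟨h', hh'0, by omega, by omega⟩

/-! ### K1 on the window is necessary -/

/-- Arithmetic room for one permanent factor: `2^((a+k)^k) + n ≤ 2^((a+k+2)^(k+2))` whenever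
`log₂ n ≤ a`. [folklore] -/
theorem qp_step (a k n : ℕ) (hn : Nat.log 2 n ≤ a) :
    2 ^ ((a + k) ^ k) + n ≤ 2 ^ ((a + (k + 2)) ^ (k + 2)) := by
  have hlt : n < 2 ^ (Nat.log 2 n + 1) := Nat.lt_pow_succ_log_self one_lt_two n
  have hE1 : (a + k) ^ k + 1 ≤ (a + (k + 2)) ^ (k + 2) := by
    have : (a + k) ^ k < (a + (k + 2)) ^ (k + 2) :=
      calc (a + k) ^ k ≤ (a + (k + 2)) ^ k := Nat.pow_le_pow_left (by omega) _
        _ < (a + (k + 2)) ^ (k + 2) := Nat.pow_lt_pow_right (by omega) (by omega)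
    omega
  have hE2 : Nat.log 2 n + 2 ≤ (a + (k + 2)) ^ (k + 2) :=
    calc Nat.log 2 n + 2 ≤ a + (k + 2) := by omega
      _ ≤ (a + (k + 2)) ^ (k + 2) := Nat.le_self_pow (by omega) _
  obtain ⟨E, hE⟩ : ∃ E, E + 1 = (a + (k + 2)) ^ (k + 2) :=
    ⟨(a + (k + 2)) ^ (k + 2) - 1, by omega⟩
  rw [← hE] at hE1 hE2 ⊢
  have h1 : 2 ^ ((a + k) ^ k) ≤ 2 ^ E := Nat.pow_le_pow_right two_pos (by omega)
  have h2 : n ≤ 2 ^ E :=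
    hlt.le.trans (Nat.pow_le_pow_right two_pos (by omega))
  have h3 : 2 ^ E + 2 ^ E = 2 ^ (E + 1) := by rw [pow_succ]; ring
  omega

/-- **K1 is necessary** (`stub_creationDegree ⇐ crux`): the field-side half cannot be more false than
the crux — take `A := per_n · h'` (one permanent factor of degree `n ≤ 2^(log₂ n + 1)` is absorbed by
`qp_step`, `k ↦ k + 2`). [prime-walk-positivizer, Transfer] -/
theorem creationDegree_of_perCofactorDegreeReduction
    (hC : Summit.ValiantsHypothesis.ValiantsHypothesis.Theses.DivisionGap.PerCofactorDegreeReduction) :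
    ∃ k : ℕ, ∀ (n : ℕ) (g : MvPolynomial (Fin n × Fin n) ℝ≥0), g ≠ 0 →
      perPoly (Fin n) ℝ≥0 ∣ g →
      ∃ A : MvPolynomial (Fin n × Fin n) ℝ≥0, A ≠ 0 ∧
        perPoly (Fin n) ℝ ∣ MvPolynomial.map NNReal.toRealHom A ∧
        A.totalDegree ≤ 2 ^ ((Nat.log 2 n + Nat.log 2 (complexity g) + k) ^ k) ∧
        complexity A ≤ 2 ^ ((Nat.log 2 n + Nat.log 2 (complexity g) + k) ^ k) := by
  classical
  obtain ⟨k, hk⟩ := hC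
  refine ⟨k + 2, fun n g hg hdvd => ?_⟩
  obtain ⟨h, rfl⟩ := hdvd
  have hh : h ≠ 0 := by rintro rfl; exact hg (mul_zero _)
  obtain ⟨h', hh', hdeg, hL⟩ := hk n h hh
  have hroom := qp_step (Nat.log 2 n + Nat.log 2 (complexity (perPoly (Fin n) ℝ≥0 * h))) k n
    (Nat.le_add_right _ _)
  have hdegper : (perPoly (Fin n) ℝ≥0).totalDegree = n := by
    simpa using (totalDegree_perPoly_holds (n := Fin n) (k := ℝ≥0))
  refine ⟨perPoly (Fin n) ℝ≥0 * h', mul_ne_zero (perPoly_ne_zero _ _) hh', ?_, ?_, ?_⟩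
  · rw [map_mul, map_perPoly]; exact dvd_mul_right _ _
  · calc (perPoly (Fin n) ℝ≥0 * h').totalDegree
        ≤ (perPoly (Fin n) ℝ≥0).totalDegree + h'.totalDegree := totalDegree_mul _ _
      _ ≤ 2 ^ ((Nat.log 2 n + Nat.log 2 (complexity (perPoly (Fin n) ℝ≥0 * h)) + (k + 2)) ^ (k + 2)) := by
          rw [hdegper]; omega
  · omega

/-- **K1|window is necessary for the crux**: the open stub `stub_creationDegreeWindow` of line
`Sketch` (a nonzero nonnegative `A ∈ (per_n)ℝ[x]` with `deg A, L(A) ≤ B` for every cheap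
single-typed content-free cofactor `h` in the window) follows from `PerCofactorDegreeReduction`
(restrict `creationDegree_of_perCofactorDegreeReduction` to the window). [prime-walk-positivizer,
Transfer] -/
theorem creationDegreeWindow_of_perCofactorDegreeReduction
    (hC : Summit.ValiantsHypothesis.ValiantsHypothesis.Theses.DivisionGap.PerCofactorDegreeReduction) :
    ∃ k : ℕ, ∀ (n : ℕ) (h : MvPolynomial (Fin n × Fin n) ℝ≥0), h ≠ 0 →
      (∃ τ : (Fin n →₀ ℕ) × (Fin n →₀ ℕ),
          ∀ m ∈ h.support, (Finsupp.mapDomain Prod.fst m, Finsupp.mapDomain Prod.snd m) = τ) →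
      (∀ v : Fin n × Fin n, ∃ m ∈ h.support, m v = 0) →
      2 ^ ((Nat.log 2 n + Nat.log 2 (complexity (perPoly (Fin n) ℝ≥0 * h)) + k) ^ k) <
        complexity (perPoly (Fin n) ℝ≥0) →
      2 ^ ((Nat.log 2 n + Nat.log 2 (complexity (perPoly (Fin n) ℝ≥0 * h)) + k) ^ k) <
        h.totalDegree →
      ∃ A : MvPolynomial (Fin n × Fin n) ℝ≥0, A ≠ 0 ∧
        perPoly (Fin n) ℝ ∣ MvPolynomial.map NNReal.toRealHom A ∧
        A.totalDegree ≤
          2 ^ ((Nat.log 2 n + Nat.log 2 (complexity (perPoly (Fin n) ℝ≥0 * h)) + k) ^ k) ∧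
        complexity A ≤
          2 ^ ((Nat.log 2 n + Nat.log 2 (complexity (perPoly (Fin n) ℝ≥0 * h)) + k) ^ k) := by
  obtain ⟨k, hk⟩ := creationDegree_of_perCofactorDegreeReduction hC
  refine ⟨k, fun n h hh _ _ _ _ => ?_⟩
  exact hk n (perPoly (Fin n) ℝ≥0 * h) (mul_ne_zero (perPoly_ne_zero _ _) hh) (dvd_mul_right _ _)

end Summit.ValiantsHypothesis.ValiantsHypothesis.Theorems.DivisionGap.PerCofactorDegreeReduction.Window

end
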